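import Mathlib
import HarnessLib
import HarnessLib.Audit
import Summits.SmoothPoincare4.Statement
import Literature.Geometry.Lorentzian.Volume
import Literature.Geometry.Lorentzian.PseudoRiemannianMetric
import Literature.Geometry.Lorentzian.LeviCivita
import Literature.Geometry.Lorentzian.LeviCivitaProofs
import Literature.Topology.FourManifolds.HomotopyS4CompactProofs
import Literature.Topology.FourManifolds.SphereSimplyConnected
import HarnessLib.Audit.Status.Attr

/-!
Route: SpectralDevelopingMap

DORMANT since 2026-08-22T09:37:05Z (reconciler: no traction for 5.2 d (last activity item-evidence-added at 2026-08-17T03:09:11Z); parked, not closed — `ledger route dormant route-SmoothPoincare4-SpectralDevelopingMap --off` to reactiva) — unstaffed, not closed; items shared with open routes are served there. `ledger route dormant <id> --off` reactivates.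

# Route SpectralDevelopingMap — ground-state harmonic maps to S⁴ as canonical developing maps —
degree-one ground states unfold, and every metric on a homotopy 4-sphere has one

It suffices to show X = U ∧ H (card spectral-developing-maps, items 1, 2 and 4, recast in
Karpukhin–Stern's weighted language).
Call a smooth Φ : (Σ⁴, g) → S⁴ ⊂ ℝ⁵ a GROUND-STATE MAP if its five coordinates solve Δ_g Φᵢ = −E·Φᵢ
with E = |dΦ|²_g
(this is exactly the harmonic-map equation into the round sphere, Takahashi) AND are ground states
of the weighted problem,
λ₁(g, E) = 1 (Rayleigh: ∫E u = 0 ⇒ ∫E u² ≤ ∫|du|²); E ≡ const is the card's case "Φ =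
first-five-eigenfunction map of a
λ̄₁-conformally-critical metric" (El Soufi–Ilias). U (GroundStateMapsUnfold): on a homotopy 4-sphere
every ground-state map that
is a homotopy equivalence is a local diffeomorphism. H (EveryMetricHearsSphere): for EVERY
Riemannian metric on a homotopy 4-sphere
such a ground-state homotopy equivalence exists. U ∧ H give, for any metric, an unfolded canonical
map Σ → S⁴, hence (covering
theory, proved in tree) Σ ≅ S⁴; in particular they give the card's certificate statement X₀ =
SpectralDevelopingMapExists (target,
SPC4-equivalent: some metric makes a Laplace eigenmap Σ → S⁴ a local diffeomorphism), whose Lean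
form is:
Lean: `∀ (M : Type) [TopologicalSpace M] [T2Space M] [SecondCountableTopology M] [ChartedSpace
(EuclideanSpace ℝ (Fin 4)) M] [IsManifold (𝓡 4) ∞ M], Nonempty (M ≃ₕ (Metric.sphere (0 :
EuclideanSpace ℝ (Fin 5)) 1)) → ∃ (g : Bundle.ContMDiffRiemannianMetric (𝓡 4) ∞ (EuclideanSpace ℝ
(Fin 4)) (TangentSpace (𝓡 4) : M → Type _)) (_ :
(Literature.Geometry.Lorentzian.PseudoRiemannianMetric.ofRiemannian g).HasLeviCivita) (c : ℝ) (Φ : M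
→ Metric.sphere (0 : EuclideanSpace ℝ (Fin 5)) 1), 0 < c ∧ ContMDiff (𝓡 4) (𝓡 4) ∞ Φ ∧ (∀ (i : Fin
5) (x : M), (Literature.Geometry.Lorentzian.PseudoRiemannianMetric.ofRiemannian g).dalembertian (fun
y => (Φ y : EuclideanSpace ℝ (Fin 5)) i) x = -c * (Φ x : EuclideanSpace ℝ (Fin 5)) i) ∧
IsLocalDiffeomorph (𝓡 4) (𝓡 4) ∞ Φ`

## Assembly
Bookkeeping plus the covering lemma: given M ≃ₕ S⁴ with a smooth atlas, M is compact
(`compactSpace_of_homotopyEquiv_sphere_four`),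
T₃ (Hausdorff + locally compact) and connected (homotopy equivalent to S⁴); give it its Borel
σ-algebra; RiemannianMetricExists supplies g;
EveryMetricHearsSphere supplies a ground-state homotopy equivalence Φ : M → S⁴;
GroundStateMapsUnfold makes Φ a local diffeomorphism;
`Literature.Geometry.Riemannian.diffeomorphOfIsLocalDiffeomorph` (with
`simplyConnectedSpace_euclideanSphere 4`) upgrades it to
M ≃ₘ S⁴, i.e. `HomotopyEquiv.NonemptyDiffeomorphSphere M 4`, i.e. SmoothPoincare4. All decls
elaborate (planner Sketch.lean, rc 0).

Rationale: WHY THIS LINE. On the round S⁴ the five gravest eigenfunctions ARE the coordinates; the card asks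
whether every homotopy 4-sphere can be tuned until
its gravest modes draw it without folds, and observes that a local diffeomorphism Σ⁴ → S⁴ from a
closed manifold is a diffeomorphism
(Kuiper's developing-map argument, `Literature.Geometry.Riemannian.diffeomorphOfIsLocalDiffeomorph`,
proved). Two facts found this
session make that a route rather than a tautology: (i) a fold of Φ = (f₁,…,f₅) at x is exactly a
critical zero of the ground state
a·Φ (a ⊥ Φ(x), a ⊥ im dΦₓ), so U is a statement about nodal sets of FIRST eigenfunctions, whose
2-dimensional analogue is a theorem
(Cheng1976: on S² a first eigenfunction has an embedded nodal circle, so first-eigenfunction maps S²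
→ S² never fold; EellsWood1976:
degree-one harmonic S² → S² is Möbius), while degree-one harmonic self-maps of the round S⁴ WITH
folds exist (BizonChmaj1997,
corotational, nodal number ≥ 3) and fail precisely the ground-state clause — in the corotational
class the ground-state clause kills
folds by a two-line Sturm argument (support CorotationalNoFold); (ii) existence theory now exists in
the weighted form: for every metric
on a closed 4-manifold Karpukhin–Stern (KarpukhinStern2024 Cor. 1.3, Prop. 1.4, Thm. 1.5) produce
smooth sphere-valued harmonic maps
by first weighted eigenfunctions (ground-state maps to some S^k), and Petrides2022 Thm. 0.1 /
KarpukhinMetras2022 do the conformal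
(n-harmonic) version, so H asks only that k = 4 and degree ±1 on homotopy spheres. Imported areas:
spectral geometry / eigenvalue
optimisation (ElsoufiIlias1986, ElsoufiIlias2008, KarpukhinStern2024, Petrides2022), harmonic maps
between spheres (BizonChmaj1997,
EellsRatto1993, White1986), nodal geometry (Cheng1976), Ricci almost-rigidity for the rung
(Petersen1999, Aubry2005), and the
manifold-learning dictionary eigenmap ↦ developing map (BerardBessonGallot1994, Bates2014,
Portegies2016). No prior route on this summit
is spectral or harmonic-map based (EntropyLadder is MCF entropy, WeylBudget/PIC are curvature
conditions); negatives index empty.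

RANKED CRUXES. #0 SpectralDevelopingMapExists (target) — every smooth homotopy 4-sphere M carries a
Riemannian metric g, a constant c > 0 and a smooth map Φ : M → S⁴ ⊂ ℝ⁵ whose five coordinates are
Δ_g-eigenfunctions with eigenvalue c (a spherical eigenmap; harmonic with |dΦ|² ≡ c) and which is a
local diffeomorphism (card SPEC-EXIST / CERT). Equivalent to SPC4 (round metric and c = 4 one way,
covering theory the other); U ∧ H produce it with the pulled-back round metric. (why it might fail:
⇔ SPC4: an exotic Σ admits no unfolded eigenmap for any metric; as a programme it stands only
through U ∧ H below (or the FEM engine on explicit candidates).) [Kuiper1949, Takahashi1966,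
BerardBessonGallot1994, Bates2014, Portegies2016]
#2 GroundStateMapsUnfold (crux) — (U, card UNFOLD in ground-state form) M a closed smooth
4-manifold, g Riemannian, Φ : M → S⁴ smooth and a homotopy equivalence, with Δ_g Φᵢ = −E Φᵢ for E =
Σᵢ |dΦᵢ|²_g (harmonic map equation) and λ₁(g, E) ≥ 1 (∀ smooth u, ∫ E u dμ_g = 0 ⇒ ∫ E u² dμ_g ≤ ∫
|du|²_g dμ_g: the Φᵢ are ground states) ⟹ Φ is a C^∞ local diffeomorphism. E ≡ λ₁(g) constant is the
first-five-eigenfunction case. [difficulty: XL] (why it might fail: folds are generic for maps Σ⁴→S⁴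
and a fold is just a critical zero of the ground state a·Φ; in dim 4 a (2,2)-Morse critical zero has
two local nodal domains, so Courant obstructs nothing (Cheng's S² argument dies); Bizoń–Chmaj's
folded degree-1 harmonic S⁴→S⁴ fail only the ground-state clause.) [BizonChmaj1997, Cheng1976,
EellsWood1976, KarpukhinStern2024, ElsoufiIlias2008, Takahashi1966]
#3 EveryMetricHearsSphere (crux) — (H, card MULT5 in ground-state form) for every closed smooth
4-manifold M homotopy equivalent to S⁴ and EVERY Riemannian metric g on M there is a smooth Φ : M →
S⁴, a homotopy equivalence, which is a ground-state map for g (Δ_g Φᵢ = −E Φᵢ, E = |dΦ|²_g, λ₁(g,E)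
≥ 1). On the round S⁴, Φ = id (E ≡ 4 = λ₁). Karpukhin–Stern give ground-state maps (M,g) → S^k for
every g; H says k = 4 and degree ±1 is achievable. [difficulty: open-problem] (why it might fail:
even a degree-±1 harmonic map (S⁴,g)→S⁴ for every g is open (inf E = 0 in every class, White1986; KS
min-max maps have uncontrolled degree), and KS ground states may land in S^k, k ≠ 4 (metrics of
minimal S⁴ ↪ S⁵ by first eigenfunctions would force k ≥ 5).) [KarpukhinStern2024, White1986,
KarpukhinMetras2022, Petrides2022, ElsoufiIlias1986]
#4 PinchedEigenmapsUnfold (crux) — (card item 2, the pinching rung, eigenmap clause made explicit)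
there is ε > 0 such that for every closed connected Riemannian 4-manifold with Ric ≥ 3g and any five
L²(μ_g)-orthonormal smooth eigenfunctions f₁..f₅, Δ_g fᵢ = −μᵢ fᵢ with 0 < μᵢ ≤ 4 + ε (so λ₅ ≤ 4+ε;
Petersen/Aubry: M ≅ S⁴), the map F = (f₁,…,f₅) : M → ℝ⁵ is transversally immersive: dFₓ injective
and F(x) ∉ im dFₓ for all x — i.e. F/|F| : M → S⁴ is the unfolded certificate. [difficulty: L] (why
it might fail: Ric ≥ 3 with λ₅ ≤ 4+ε controls eigenfunctions in W^(2, 2), C^α and Lipschitz norms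
and gives GH-closeness (Petersen, Aubry, Cheeger–Colding), not C¹-closeness to linear functions; dF
may degenerate on tiny high-curvature bumps although M ≅ S⁴.) [Petersen1999, Aubry2005,
CheegerColding1997, Portegies2016]
#9 CorotationalNoFold (support) — (ODE core of U for cohomogeneity-one data; proof sketched in
NOTES) R > 0, b ∈ C¹(0,R) positive, α ∈ C²(0,R) ∩ C[0,R] with α(0) = 0, α(R) = π solving the
corotational harmonic-map equation α'' + 3(b'/b)α' = 3 sin α cos α / b² (the ground-state map Φ =
(cos α, sin α·ω) on the warped S⁴ = dr² + b² g_S³), and cos α vanishing at most once in (0,R) (Sturm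
consequence of the ground-state clause in the radial sector) ⟹ α' ≠ 0 on (0,R): no folds. Proof: at
a critical point sign α'' = sign sin 2α, so a critical point is a strict extremum on the wrong side
of π/2, forcing a second zero of cos α (IVT + extreme value + ODE uniqueness for sin 2α = 0).
[difficulty: M] [BizonChmaj1997, EellsRatto1993]
#9 RiemannianMetricExists (support) — every Hausdorff second-countable smooth 4-manifold carries a
C^∞ Riemannian metric on its tangent bundle (partition of unity; adapt
Literature/Geometry/Kaehler/HermitianMetricExists.lean without the complex structure). Needed to
instantiate H in the Assembly. [difficulty: M] [LeeSmoothManifolds2013]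
#9 FoldIsNodalCriticalPoint (support) — (the bridge from U to nodal geometry) for a smooth Φ : M⁴ →
S⁴ ⊂ ℝ⁵ and x ∈ M: Φ is a local diffeomorphism at x iff no nonzero a ∈ ℝ⁵ with ⟪a, Φ(x)⟫ = 0 has
d⟪a, Φ⟫ₓ = 0 (linear algebra: im dΦₓ ⊂ Φ(x)^⊥ has full rank 4 iff its annihilator in Φ(x)^⊥ is 0;
plus the manifold inverse function theorem
`Literature.Topology.FourManifolds.isLocalDiffeomorphAt_of_mfderiv`). [difficulty: provable-now]
[LeeSmoothManifolds2013]
#9 UnfoldedMapIsStandard (support) — (soundness of the certificate, card item 1)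
SpectralDevelopingMapExists → SmoothPoincare4: a local diffeomorphism from a compact connected
Hausdorff 4-manifold to the simply connected S⁴ is a diffeomorphism
(`Literature.Geometry.Riemannian.diffeomorphOfIsLocalDiffeomorph`,
`simplyConnectedSpace_euclideanSphere`; compactness and connectedness of M from M ≃ₕ S⁴).
[difficulty: provable-now] [HatcherAT2002, Kuiper1949]

TWO-LAYER PLAN. Foreseen glued splits (none filed now; k ≤ 3, depth 1): GroundStateMapsUnfold ⇐
NoCriticalZeroOfGroundStates (no ground state in
span{Φᵢ} has a critical zero, via Courant-type nodal topology or a Bochner/maximum-principle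
identity for |d(a·Φ)|² + (a·Φ)²·(…)) →
FoldIsNodalCriticalPoint → U. EveryMetricHearsSphere ⇐ KSWidthMapDegreeOne (the Karpukhin–Stern
width map u₄ : (Σ,g) → S⁴ of
Cor. 1.3, index ≤ 5, has degree ±1 on a homotopy sphere) → KSWidthMapGroundState (λ₁(g, e(u₄)) = 1)
→ H. PinchedEigenmapsUnfold ⇐
C¹-control of first eigenfunctions under Ric ≥ 3 ∧ λ₅ ≤ 4+ε → transversality → Pinched.
Cohomogeneity-one case of U ⇐ WarpedReduction
(SO(4)-invariant g: ground-state homotopy equivalences are corotational; Sturm ⇒ cos α has one zero)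
→ CorotationalNoFold.

KILL CRITERIA. A ground-state homotopy equivalence (Σ,g) → S⁴ WITH a fold refutes
GroundStateMapsUnfold: if its density E is non-constant (weighted,
Karpukhin–Stern side) the route pivots by `--restate GroundStateMapsUnfold` to the constant-E form
(first-five-eigenfunction maps of
λ̄₁-conformally-critical metrics, the card's literal UNFOLD) and H to the conformal-class form
(Petrides2022 maximisers); a fold with
E ≡ λ₁(g) constant (a λ₁-critical metric on S⁴ whose first-eigenfunction map folds) closes the route
`refuted:GroundStateMapsUnfold` —
the spectral developing map is then a heuristic only. A metric g on S⁴ with NO ground-state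
degree-one map refutes EveryMetricHearsSphere
as filed: restate to "some metric in every conformal class" (Λ₁-maximiser form) or close if that
also fails on S⁴. PinchedEigenmapsUnfold
is a rung, not load-bearing: its refutation is recorded and dropped (`--drop`). SPC4 proved
elsewhere moots everything (round metric);
an exotic 4-sphere makes H false on it and closes the route with the problem.

NOT DECOMPOSED YET. The card's numerical ENGINE (FEM eigenvectors with enclosures on triangulated
candidate spheres + the local-injectivity checker of card
developing-map-certificates, conformal λ₁-ascent) — kit jobs in tenure, no Lean items; the
AM–GM/Jacobian inequality λ² vol(Σ,g) ≥
16·vol(S⁴)·|deg Φ| with rigidity (needs the area formula on manifolds, absent from Mathlib); the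
conformal-class (Λ₁, n-harmonic,
KarpukhinMetras2022/Petrides2022) variants of U and H, kept as the restatement reserve; the spectral
embedding number sd(Σ) of the card
(dictionary item 5); openness of CERT under C²-perturbation of the round metric (routine
perturbation theory, would need a topology on
metrics); pole regularity and the Sturm step of the corotational reduction (layer-2 glue
WarpedReduction); named-fact versions of
KarpukhinStern2024 Thm 1.5 and Petersen1999/Aubry2005 (cite items to be filed by grounders if
provers want them as hypotheses).

CHEAPEST FALSIFIER. The corotational (SO(4)-symmetric) test is settled in favour of U by hand
(support CorotationalNoFold: sign α'' = sign sin 2α at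
critical points + one nodal zero), and Bizoń–Chmaj's folded maps are excluded exactly by the
ground-state clause — so the cheapest live
test is cohomogeneity TWO: for SO(3)×SO(2)-invariant doubly-warped metrics on S⁴ the ground-state
map equations reduce to an elliptic
system on the 2-dimensional orbit quadrant; a kit FEM computation of Karpukhin–Stern ground states
(maximise λ₁(g,β)∫β over invariant
densities, read off the map) along a 2-parameter squashing family tests U (any point with det dΦ =
0?) and H (target dimension k = 4?
degree ±1?) at once; one fold at a genuine ground state kills U, an open range of squashings with k
≠ 4 kills H(∀g). Not run here (no
kit in a plancard seat); recommended as the refuter's first job. Literature falsifier for the rung: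
if Petersen/Aubry/Honda-type
spectral convergence already yields C¹-convergence of first eigenfunctions under Ric ≥ n−1,
PinchedEigenmapsUnfold degrades to support.

NUMBERS. Round S⁴: λ₁ = 4 (multiplicity 5, linear functions), λ₂ = 10 (multiplicity 14); vol =
8π²/3; Λ₁(S⁴,[round]) = 4·(8π²/3)^(1/2)
(ElsoufiIlias1986, unique maximiser); id : S⁴ → S⁴ has |d id|² = 4, E-index 5 = k+1 (the
Karpukhin–Stern index bound at k = 4);
harmonic maps into spheres: Δu = −|du|²u; eigenmaps Sᵐ → Sⁿ by degree-d harmonic polynomials have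
|df|² = d(m+d−1) (Takahashi1966);
even-degree polynomial self-maps of S⁴ have Brouwer degree 0 (factor through ℝP⁴); Bizoń–Chmaj:
corotational harmonic self-maps of Sⁿ,
3 ≤ n ≤ 6, one for each nodal number (crossings of π/2), degree = parity; pointwise AM–GM |Jac Φ| ≤
(|dΦ|²/4)²; Petersen/Aubry
pinching: Ric ≥ n−1 ∧ λ_(n+1) ≤ n+ε(n) (Aubry: λ_n) ⇒ diffeomorphic to Sⁿ. Items at open: 9 (1
target, 3 cruxes, 4 support, 1 assembly).

DEFINITION REQUESTS. None blocking (all items elaborate over existing declarations; Δ_g is the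
tree's `PseudoRiemannianMetric.dalembertian` = tr_g Hess of `ofRiemannian g`, |du|²_g its
`innerDual`, dμ_g = `Literature.Geometry.Lorentzian.riemannianMeasure g`; the standing hypothesis
`(ofRiemannian g).HasLeviCivita` carried as a binder is a THEOREM,
`PseudoRiemannianMetric.hasLeviCivita`, kept explicit only to keep the import cone at
LeviCivita.lean + Volume.lean). Convenience notions a grounder may vend: `IsGroundStateMap g Φ`
(harmonic map into the round sphere whose coordinates are first weighted eigenfunctions; topic
Literature/Geometry/Riemannian) and
`weightedFirstEigenvalue g β` replacing the inline Rayleigh clause; cite facts wanted later: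
KarpukhinStern2024 Thm 1.5 (n = 4) and
Petersen1999 Thm 1.1 / Aubry2005 as named facts. Acquisition filed: BizonChmaj1997 full text
(acq-02402; secondary confirmation read in
Siffert, "Infinite families of harmonic self-maps of spheres", §2.3).

Novelty: Searches (2026-08-15): `lit read arxiv:2207.13635 --pages 1-6` (KarpukhinStern2024: Thm 1.1, Cor
1.3, Prop 1.4, Thm 1.5 read);
`lit read arxiv:2211.15636 --pages 1-4` (Petrides2022 Thm 0.1 read); `lit galaxy search "harmonic
maps between spheres" --star all`
(7: Eells–Ratto AM-130, Toth, Siffert 'Infinite families of harmonic self-maps of spheres' — read pp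
1-6, confirms BizonChmaj1997);
`lit search --source crossref` × 12 (Bizoń–Chmaj doi:10.1098/rspa.1997.0023, Karpukhin–Métras,
Karpukhin–Stern Invent. 2024,
Petrides, El Soufi–Ilias 1986/2008, Eells–Wood, White 1986, Bates 2014, BBG 1994, Cheng 1976,
Takahashi 1966, "harmonic map degree
one diffeomorphism sphere folds" → only Ge 2000 (into S²) and Tanno 1993); `lit search --hybrid
--source local "first eigenfunctions map
to sphere local diffeomorphism nodal set critical zero"` (10 book hits, none relevant beyond
Eells–Ratto p87); `lit read
book:eells1993… --grep` (ODE reductions, Hsiang minimal hyperspheres); `lit frontier SmoothPoincare4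
--since 2020` (30 rows, none
spectral); `lit bridges SmoothPoincare4 --cross any` (none relevant); plus the card's and the
novelty auditor's searches (Petersen/Aubry,
BBG, Portegies, spectral spherical parametrisation).
Nearest prior art found: KarpukhinStern2024 (doi:10.1007/s00222-024-01247-3: ground-state harmonic
maps to spheres exist for every
metric, dim 3–5) and Petrides2022 (arXiv:2211.15636) for existence; EellsWood1976 / Cheng1976 for
the 2-dimensional 'degree-one
harmonic maps a  [refs: 10.1098/rspa.1997.0023, 10.1007/s00222-024-01247-3:, 2207.13635, 2211.15636, arxiv:2207.13635, arxiv:2211.15636, doi:10.1098/rspa.1997.0023, book:eells1993, doi:10.1007/s00222-024-01247-3, KarpukhinStern2024, Petrides2022, BizonChmaj1997, EellsWood1976, Cheng1976, Petersen1999, Aubry2005, BerardBessonGallot1994, Bates2014, Portegies2016]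

Barriers (technique_class: spectral-certificate, harmonic-eigenmap, nodal-topology): - technique_class: spectral-certificate, harmonic-eigenmap, nodal-topology
- Literature.Barriers.SmoothPoincare4.TopologicalBarrierFour: evaded — everything is computed from a
Riemannian metric on the given smooth structure (Laplacian, harmonic-map equation, dΦ); the
conclusion is a diffeomorphism built from a smooth local diffeomorphism, not a homeomorphism
invariant.
- Literature.Barriers.SmoothPoincare4.TwistedSphereBarrierFour: not on the path — positive side; Σ ≅
S⁴ comes from covering theory applied to an unfolded map, never from a presentation D⁴ ∪_φ D⁴ or Γ₄
= 0.
- Literature.Barriers.SmoothPoincare4.HCobordismBarrierFour: not invoked — no h-cobordism, cork or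
handle argument anywhere in the assembly.
- Literature.Barriers.SmoothPoincare4.OpenAnalogueBarrierFour: consistent — compactness of Σ is used
essentially twice (ground states exist and the local-diffeomorphism-is-a-covering step), so nothing
is claimed for open ℝ⁴-homeomorphs, where the analogue is false.
- Literature.Barriers.SmoothPoincare4.GaugeSumBarrierFour: not applicable — no invariant is used to
separate; honest weakness shared with all certificate lines: the route is one-sided (it can certify
standardness, it cannot exhibit exoticness), so StableBarrierFour / HCobordismInvariantBarrierFour
are moot rather than evaded.
- Negatives index: empty at filing (ledger negatives --problem SmoothPoincare4: 0 refuted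
statements, 2026-08-15).

History (route lifecycle, newest last):
- 2026-08-22T09:37:05Z · DORMANT — reconciler: no traction for 5.2 d (last activity item-evidence-added at 2026-08-17T03:09:11Z); parked, not closed — `ledger route dormant route-SmoothPoincare4- (operator:999:838992)

sub-problem: SmoothPoincare4 · status: dormant · opened planner-plancard-SmoothPoincare4-SmoothPoinca-21d21616-0 2026-08-15T12:08:55Z · rev 4 · ledger route-SmoothPoincare4-SpectralDevelopingMap
GENERATED by the gate from the ledger (D-0016/17). Provers cite these decls: `theorem foo : Summit.SmoothPoincare4.SmoothPoincare4.Theses.SpectralDevelopingMap.<Decl> := …` in Summits/SmoothPoincare4/SmoothPoincare4/Theorems/<Name>.lean.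
-/

namespace Summit.SmoothPoincare4.SmoothPoincare4.Theses.SpectralDevelopingMap

open scoped BigOperators Topology Manifold Classical MeasureTheory ProbabilityTheory Matrix InnerProductSpace ComplexConjugate ContinuousMap ContDiff
open Filter Set Function TopologicalSpace MeasureTheory

attribute [summit_statement] _root_.SmoothPoincare4

open Literature.SPC4

/-- item stmt-SmoothPoincare4-7411 · target · rank 0 · open · by planner
why it might fail: ⇔ SPC4: an exotic Σ admits no unfolded eigenmap for any metric; as a programme it stands only through U ∧ H below (or the FEM engine on explicit candidates).
sources: Kuiper1949, Takahashi1966, BerardBessonGallot1994, Bates2014, Portegies2016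
[target] every smooth homotopy 4-sphere M carries a Riemannian metric g, a constant c > 0 and a
smooth map Φ : M → S⁴ ⊂ ℝ⁵ whose five coordinates are Δ_g-eigenfunctions with eigenvalue c (a
spherical eigenmap; harmonic with |dΦ|² ≡ c) and which is a local diffeomorphism (card SPEC-EXIST /
CERT). Equivalent to SPC4 (round metric and c = 4 one way, covering theory the other); U ∧ H produce
it with the pulled-back round metric. -/
@[route_item "route-SmoothPoincare4-SpectralDevelopingMap"]
def SpectralDevelopingMapExists : Prop :=
  ∀ (M : Type) [TopologicalSpace M] [T2Space M] [SecondCountableTopology M] [ChartedSpace (EuclideanSpace ℝ (Fin 4)) M] [IsManifold (𝓡 4) ∞ M], Nonempty (M ≃ₕ (Metric.sphere (0 : EuclideanSpace ℝ (Fin 5)) 1)) → ∃ (g : Bundle.ContMDiffRiemannianMetric (𝓡 4) ∞ (EuclideanSpace ℝ (Fin 4)) (TangentSpace (𝓡 4) : M → Type _)) (_ : (Literature.Geometry.Lorentzian.PseudoRiemannianMetric.ofRiemannian g).HasLeviCivita) (c : ℝ) (Φ : M → Metric.sphere (0 : EuclideanSpace ℝ (Fin 5)) 1), 0 < c ∧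 ContMDiff (𝓡 4) (𝓡 4) ∞ Φ ∧ (∀ (i : Fin 5) (x : M), (Literature.Geometry.Lorentzian.PseudoRiemannianMetric.ofRiemannian g).dalembertian (fun y => (Φ y : EuclideanSpace ℝ (Fin 5)) i) x = -c * (Φ x : EuclideanSpace ℝ (Fin 5)) i) ∧ IsLocalDiffeomorph (𝓡 4) (𝓡 4) ∞ Φ

/-- item stmt-SmoothPoincare4-7412 · crux · rank 2 · open · by planner
why it might fail: folds are generic for maps Σ⁴→S⁴ and a fold is just a critical zero of the ground state a·Φ; in dim 4 a (2,2)-Morse critical zero has two local nodal domains, so Courant obstructs nothing (Cheng's S² argument dies); Bizoń–Chmaj's folded degree-1 harmonic S⁴→S⁴ fail only the ground-state clause.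
sources: BizonChmaj1997, Cheng1976, EellsWood1976, KarpukhinStern2024, ElsoufiIlias2008, Takahashi1966
[crux] (U, card UNFOLD in ground-state form) M a closed smooth 4-manifold, g Riemannian, Φ : M → S⁴
smooth and a homotopy equivalence, with Δ_g Φᵢ = −E Φᵢ for E = Σᵢ |dΦᵢ|²_g (harmonic map equation)
and λ₁(g, E) ≥ 1 (∀ smooth u, ∫ E u dμ_g = 0 ⇒ ∫ E u² dμ_g ≤ ∫ |du|²_g dμ_g: the Φᵢ are ground
states) ⟹ Φ is a C^∞ local diffeomorphism. E ≡ λ₁(g) constant is the first-five-eigenfunction case.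
[difficulty: XL] -/
@[route_item "route-SmoothPoincare4-SpectralDevelopingMap", crux]
def GroundStateMapsUnfold : Prop :=
  ∀ (M : Type) [TopologicalSpace M] [T2Space M] [SecondCountableTopology M] [ChartedSpace (EuclideanSpace ℝ (Fin 4)) M] [IsManifold (𝓡 4) ∞ M] [CompactSpace M] [T3Space M] [MeasurableSpace M] [BorelSpace M] (g : Bundle.ContMDiffRiemannianMetric (𝓡 4) ∞ (EuclideanSpace ℝ (Fin 4)) (TangentSpace (𝓡 4) : M → Type _)) (_ : (Literature.Geometry.Lorentzian.PseudoRiemannianMetric.ofRiemannian g).HasLeviCivita) (Φ : M → Metric.sphere (0 : EuclideanSpace ℝ (Fin 5)) 1) (E : M → ℝ), ContMDiff (𝓡 4) (𝓡 4) ∞ Φ → (∃ e : M ≃ₕ (Metric.sphere (0 : EuclideanSpace ℝ (Fin 5)) 1), (e : M → Metric.sphere (0 : EuclideanSpace ℝ (Fin 5)) 1) = Φ) → (∀ x, E x = ∑ i : Fin 5, (Literature.Geometry.Lorentzian.PseudoRiemannianMetric.ofRiemannian g).innerDual x (mvfderiv (𝓡 4) (fun y => (Φ y : EuclideanSpace ℝ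 (Fin 5)) i) x).toLinearMap (mvfderiv (𝓡 4) (fun y => (Φ y : EuclideanSpace ℝ (Fin 5)) i) x).toLinearMap) → (∀ (i : Fin 5) (x : M), (Literature.Geometry.Lorentzian.PseudoRiemannianMetric.ofRiemannian g).dalembertian (fun y => (Φ y : EuclideanSpace ℝ (Fin 5)) i) x = -(E x) * (Φ x : EuclideanSpace ℝ (Fin 5)) i) → (∀ u : M → ℝ, ContMDiff (𝓡 4) 𝓘(ℝ, ℝ) ∞ u → ∫ x, E x * u x ∂(Literature.Geometry.Lorentzian.riemannianMeasure g) = 0 → ∫ x, E x * u x ^ 2 ∂(Literature.Geometry.Lorentzian.riemannianMeasure g) ≤ ∫ x, (Literature.Geometry.Lorentzian.PseudoRiemannianMetric.ofRiemannian g).innerDual x (mvfderiv (𝓡 4) u x).toLinearMap (mvfderiv (𝓡 4) u x).toLinearMap ∂(Literature.Geometry.Lorentzian.riemannianMeasure g)) → IsLocalDiffeomorph (𝓡 4) (𝓡 4) ∞ Φ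

/-- item stmt-SmoothPoincare4-7413 · crux · rank 3 · open · by planner
why it might fail: even a degree-±1 harmonic map (S⁴,g)→S⁴ for every g is open (inf E = 0 in every class, White1986; KS min-max maps have uncontrolled degree), and KS ground states may land in S^k, k ≠ 4 (metrics of minimal S⁴ ↪ S⁵ by first eigenfunctions would force k ≥ 5).
sources: KarpukhinStern2024, White1986, KarpukhinMetras2022, Petrides2022, ElsoufiIlias1986
[crux] (H, card MULT5 in ground-state form) for every closed smooth 4-manifold M homotopy equivalent
to S⁴ and EVERY Riemannian metric g on M there is a smooth Φ : M → S⁴, a homotopy equivalence, which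
is a ground-state map for g (Δ_g Φᵢ = −E Φᵢ, E = |dΦ|²_g, λ₁(g,E) ≥ 1). On the round S⁴, Φ = id (E ≡
4 = λ₁). Karpukhin–Stern give ground-state maps (M,g) → S^k for every g; H says k = 4 and degree ±1
is achievable. [difficulty: open-problem] -/
@[route_item "route-SmoothPoincare4-SpectralDevelopingMap", crux]
def EveryMetricHearsSphere : Prop :=
  ∀ (M : Type) [TopologicalSpace M] [T2Space M] [SecondCountableTopology M] [ChartedSpace (EuclideanSpace ℝ (Fin 4)) M] [IsManifold (𝓡 4) ∞ M] [CompactSpace M] [T3Space M] [MeasurableSpace M] [BorelSpace M] (g : Bundle.ContMDiffRiemannianMetric (𝓡 4) ∞ (EuclideanSpace ℝ (Fin 4)) (TangentSpace (𝓡 4) : M → Type _)) (_ : (Literature.Geometry.Lorentzian.PseudoRiemannianMetric.ofRiemannian g).HasLeviCivita), Nonempty (M ≃ₕ (Metric.sphere (0 : EuclideanSpace ℝ (Fin 5)) 1)) → ∃ (Φ : M → Metric.sphere (0 : EuclideanSpace ℝ (Fin 5)) 1) (E : M → ℝ), ContMDiff (𝓡 4) (𝓡 4) ∞ Φ ∧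 (∃ e : M ≃ₕ (Metric.sphere (0 : EuclideanSpace ℝ (Fin 5)) 1), (e : M → Metric.sphere (0 : EuclideanSpace ℝ (Fin 5)) 1) = Φ) ∧ (∀ x, E x = ∑ i : Fin 5, (Literature.Geometry.Lorentzian.PseudoRiemannianMetric.ofRiemannian g).innerDual x (mvfderiv (𝓡 4) (fun y => (Φ y : EuclideanSpace ℝ (Fin 5)) i) x).toLinearMap (mvfderiv (𝓡 4) (fun y => (Φ y : EuclideanSpace ℝ (Fin 5)) i) x).toLinearMap) ∧ (∀ (i : Fin 5) (x : M), (Literature.Geometry.Lorentzian.PseudoRiemannianMetric.ofRiemannian g).dalembertian (fun y => (Φ y : EuclideanSpace ℝ (Fin 5)) i) x = -(E x) * (Φ x : EuclideanSpace ℝ (Fin 5)) i) ∧ (∀ u : M → ℝ, ContMDiff (𝓡 4) 𝓘(ℝ, ℝ) ∞ u → ∫ x, E x * u x ∂(Literature.Geometry.Lorentzian.riemannianMeasure g) = 0 → ∫ x, E x * u x ^ 2 ∂(Literature.Geometry.Lorentzian.riemannianMeasure g) ≤ ∫ x, (Literature.Geometry.Lorentzian.PseudoRiemannianMetric.ofRiemannian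 g).innerDual x (mvfderiv (𝓡 4) u x).toLinearMap (mvfderiv (𝓡 4) u x).toLinearMap ∂(Literature.Geometry.Lorentzian.riemannianMeasure g))

/-- item stmt-SmoothPoincare4-7414 · crux · rank 4 · open · by planner
why it might fail: Ric ≥ 3 with λ₅ ≤ 4+ε controls eigenfunctions in W^(2, 2), C^α and Lipschitz norms and gives GH-closeness (Petersen, Aubry, Cheeger–Colding), not C¹-closeness to linear functions; dF may degenerate on tiny high-curvature bumps although M ≅ S⁴.
sources: Petersen1999, Aubry2005, CheegerColding1997, Portegies2016
[crux] (card item 2, the pinching rung, eigenmap clause made explicit) there is ε > 0 such that for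
every closed connected Riemannian 4-manifold with Ric ≥ 3g and any five L²(μ_g)-orthonormal smooth
eigenfunctions f₁..f₅, Δ_g fᵢ = −μᵢ fᵢ with 0 < μᵢ ≤ 4 + ε (so λ₅ ≤ 4+ε; Petersen/Aubry: M ≅ S⁴),
the map F = (f₁,…,f₅) : M → ℝ⁵ is transversally immersive: dFₓ injective and F(x) ∉ im dFₓ for all x
— i.e. F/|F| : M → S⁴ is the unfolded certificate. [difficulty: L] -/
@[route_item "route-SmoothPoincare4-SpectralDevelopingMap"]
def PinchedEigenmapsUnfold : Prop :=
  ∃ ε : ℝ, 0 < ε ∧ ∀ (M : Type) [TopologicalSpace M] [T2Space M] [SecondCountableTopology M] [ChartedSpace (EuclideanSpace ℝ (Fin 4)) M] [IsManifold (𝓡 4) ∞ M] [CompactSpace M] [ConnectedSpace M] [T3Space M] [MeasurableSpace M] [BorelSpace M] (g : Bundle.ContMDiffRiemannianMetric (𝓡 4) ∞ (EuclideanSpace ℝ (Fin 4)) (TangentSpace (𝓡 4) : M → Type _)) (_ : (Literature.Geometry.Lorentzian.PseudoRiemannianMetric.ofRiemannian g).HasLeviCivita) (f : Fin 5 → M →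 ℝ) (μ : Fin 5 → ℝ), (∀ (x : M) (v : TangentSpace (𝓡 4) x), 3 * g.inner x v v ≤ (Literature.Geometry.Lorentzian.PseudoRiemannianMetric.ofRiemannian g).ricci x v v) → (∀ i, ContMDiff (𝓡 4) 𝓘(ℝ, ℝ) ∞ (f i)) → (∀ (i : Fin 5) (x : M), (Literature.Geometry.Lorentzian.PseudoRiemannianMetric.ofRiemannian g).dalembertian (f i) x = -(μ i) * f i x) → (∀ i, 0 < μ i ∧ μ i ≤ 4 + ε) → (∀ i j, ∫ x, f i x * f j x ∂(Literature.Geometry.Lorentzian.riemannianMeasure g) = if i = j then 1 else 0) → ∀ x : M, Function.Injective (mvfderiv (𝓡 4) (fun y => (WithLp.toLp 2 (fun i => f i y) : EuclideanSpace ℝ (Fin 5))) x) ∧ (WithLp.toLp 2 (fun i => f i x) : EuclideanSpace ℝ (Fin 5)) ∉ LinearMap.range (mvfderiv (𝓡 4) (fun y => (WithLp.toLp 2 (fun i => f i y) : EuclideanSpace ℝ (Fin 5))) x).toLinearMap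

/-- item stmt-SmoothPoincare4-7415 · support · rank 9 · open · by planner
sources: BizonChmaj1997, EellsRatto1993
[support] (ODE core of U for cohomogeneity-one data; proof sketched in NOTES) R > 0, b ∈ C¹(0,R)
positive, α ∈ C²(0,R) ∩ C[0,R] with α(0) = 0, α(R) = π solving the corotational harmonic-map
equation α'' + 3(b'/b)α' = 3 sin α cos α / b² (the ground-state map Φ = (cos α, sin α·ω) on the
warped S⁴ = dr² + b² g_S³), and cos α vanishing at most once in (0,R) (Sturm consequence of the
ground-state clause in the radial sector) ⟹ α' ≠ 0 on (0,R): no folds. Proof: at a critical point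
sign α'' = sign sin 2α, so a critical point is a strict extremum on the wrong side of π/2, forcing a
second zero of cos α (IVT + extreme value + ODE uniqueness for sin 2α = 0). [difficulty: M] -/
@[route_item "route-SmoothPoincare4-SpectralDevelopingMap"]
def CorotationalNoFold : Prop :=
  ∀ (R : ℝ) (b α : ℝ → ℝ), 0 < R → ContDiffOn ℝ 1 b (Set.Ioo 0 R) → (∀ r ∈ Set.Ioo 0 R, 0 < b r) → ContDiffOn ℝ 2 α (Set.Ioo 0 R) → ContinuousOn α (Set.Icc 0 R) → α 0 = 0 → α R = Real.pi → (∀ r ∈ Set.Ioo 0 R, deriv (deriv α) r + 3 * (deriv b r / b r) * deriv α r = 3 * Real.sin (α r) * Real.cos (α r) / b r ^ 2) → (∀ r₁ ∈ Set.Ioo 0 R, ∀ r₂ ∈ Set.Ioo 0 R, Real.cos (α r₁) = 0 → Real.cos (α r₂) = 0 → r₁ = r₂) → ∀ r ∈ Set.Ioo 0 R, deriv α r ≠ 0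

/-- item stmt-SmoothPoincare4-7416 · support · rank 9 · open · by planner
sources: LeeSmoothManifolds2013
[support] every Hausdorff second-countable smooth 4-manifold carries a C^∞ Riemannian metric on its
tangent bundle (partition of unity; adapt Literature/Geometry/Kaehler/HermitianMetricExists.lean
without the complex structure). Needed to instantiate H in the Assembly. [difficulty: M] -/
@[route_item "route-SmoothPoincare4-SpectralDevelopingMap", crux]
def RiemannianMetricExists : Prop :=
  ∀ (M : Type) [TopologicalSpace M] [T2Space M] [SecondCountableTopology M] [ChartedSpace (EuclideanSpace ℝ (Fin 4)) M] [IsManifold (𝓡 4) ∞ M], Nonempty (Bundle.ContMDiffRiemannianMetric (𝓡 4) ∞ (EuclideanSpace ℝ (Fin 4)) (TangentSpace (𝓡 4) : M → Type _))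

/-- item stmt-SmoothPoincare4-7417 · support · rank 9 · open · by planner
sources: LeeSmoothManifolds2013
[support] (the bridge from U to nodal geometry) for a smooth Φ : M⁴ → S⁴ ⊂ ℝ⁵ and x ∈ M: Φ is a
local diffeomorphism at x iff no nonzero a ∈ ℝ⁵ with ⟪a, Φ(x)⟫ = 0 has d⟪a, Φ⟫ₓ = 0 (linear algebra:
im dΦₓ ⊂ Φ(x)^⊥ has full rank 4 iff its annihilator in Φ(x)^⊥ is 0; plus the manifold inverse
function theorem `Literature.Topology.FourManifolds.isLocalDiffeomorphAt_of_mfderiv`). [difficulty: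
provable-now] -/
@[route_item "route-SmoothPoincare4-SpectralDevelopingMap"]
def FoldIsNodalCriticalPoint : Prop :=
  ∀ (M : Type) [TopologicalSpace M] [T2Space M] [SecondCountableTopology M] [ChartedSpace (EuclideanSpace ℝ (Fin 4)) M] [IsManifold (𝓡 4) ∞ M] (Φ : M → Metric.sphere (0 : EuclideanSpace ℝ (Fin 5)) 1) (x : M), ContMDiff (𝓡 4) (𝓡 4) ∞ Φ → (IsLocalDiffeomorphAt (𝓡 4) (𝓡 4) ∞ Φ x ↔ ∀ a : EuclideanSpace ℝ (Fin 5), a ≠ 0 → inner ℝ a (Φ x : EuclideanSpace ℝ (Fin 5)) = 0 → mvfderiv (𝓡 4) (fun y => inner ℝ a (Φ y : EuclideanSpace ℝ (Fin 5))) x ≠ 0)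

/-- item stmt-SmoothPoincare4-7418 · support · rank 9 · open · by planner
sources: HatcherAT2002, Kuiper1949
[support] (soundness of the certificate, card item 1) SpectralDevelopingMapExists → SmoothPoincare4:
a local diffeomorphism from a compact connected Hausdorff 4-manifold to the simply connected S⁴ is a
diffeomorphism (`Literature.Geometry.Riemannian.diffeomorphOfIsLocalDiffeomorph`,
`simplyConnectedSpace_euclideanSphere`; compactness and connectedness of M from M ≃ₕ S⁴).
[difficulty: provable-now] -/
@[route_item "route-SmoothPoincare4-SpectralDevelopingMap"]
def UnfoldedMapIsStandard : Prop :=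
  SpectralDevelopingMapExists → SmoothPoincare4

/-- item stmt-SmoothPoincare4-7419 · assembly · rank 1 · open · by planner
sources: HatcherAT2002, LeeSmoothManifolds2013, Kuiper1949
[assembly] RiemannianMetricExists → GroundStateMapsUnfold → EveryMetricHearsSphere →
SmoothPoincare4. -/
@[route_item "route-SmoothPoincare4-SpectralDevelopingMap"]
def Assembly : Prop :=
  RiemannianMetricExists → GroundStateMapsUnfold → EveryMetricHearsSphere → SmoothPoincare4

/-! D-0027 §2.1 — DECIDING THEOREM (planner-authored via `route open/edit --closes-file`; by planner-rbadge-SmoothPoincare4-SpectralDevelop-d2d864cc-g4-0 2026-08-15T16:22:51Z):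
its hypotheses are this route's items and its conclusion the sub-problem Statement (glue_lint), and it elaborates with this file. -/

@[closes "route-SmoothPoincare4-SpectralDevelopingMap"] theorem closes (hR : RiemannianMetricExists)
    (hH : EveryMetricHearsSphere) (hU : GroundStateMapsUnfold) :
    _root_.SmoothPoincare4 := by
  unfold _root_.SmoothPoincare4 Literature.SPC4.SmoothPoincareConjectureFour
    ContinuousMap.HomotopyEquiv.NonemptyDiffeomorphSphere
  intro M _ _ _ _ _ e
  -- point-set topology of a homotopy 4-sphere
  haveI : CompactSpace M :=
    Literature.Topology.FourManifolds.compactSpace_of_homotopyEquiv_sphere_four_holds M e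
  haveI : SimplyConnectedSpace (Metric.sphere (0 : EuclideanSpace ℝ (Fin 5)) 1) :=
    Literature.Topology.FourManifolds.simplyConnectedSpace_sphere_four_holds
  haveI : SimplyConnectedSpace M := e.simplyConnectedSpace
  haveI : T3Space M := inferInstance
  letI : MeasurableSpace M := borel M
  haveI : BorelSpace M := ⟨rfl⟩
  haveI : LocallyPathConnectedSpace (Metric.sphere (0 : EuclideanSpace ℝ (Fin 5)) 1) :=
    ChartedSpace.locallyPathConnectedSpace (EuclideanSpace ℝ (Fin 4)) _
  -- a metric, its Levi-Civita connection, a ground-state homotopy equivalence, unfolded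
  obtain ⟨g⟩ := hR M
  have hg : (Literature.Geometry.Lorentzian.PseudoRiemannianMetric.ofRiemannian g).HasLeviCivita :=
    (Literature.Geometry.Lorentzian.PseudoRiemannianMetric.ofRiemannian g).hasLeviCivita
  obtain ⟨Φ, E, hΦ, he, hE, hΔ, hRay⟩ := hH M g hg ⟨e⟩
  have hloc : IsLocalDiffeomorph (𝓡 4) (𝓡 4) ∞ Φ := hU M g hg Φ E hΦ he hE hΔ hRay
  -- covering-space step: a local homeomorphism from a compact connected Hausdorff space to a
  -- simply connected, locally path connected Hausdorff space is bijective (Hatcher 1.33–1.34)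
  have hbij : Function.Bijective Φ := by
    have cov : IsCoveringMap Φ := isLocalHomeomorph_iff_isCoveringMap.mp hloc.isLocalHomeomorph
    obtain ⟨m₀⟩ : Nonempty M := inferInstance
    obtain ⟨s, ⟨hs₀, hs⟩, -⟩ :=
      cov.existsUnique_continuousMap_lifts (ContinuousMap.id _) (Φ m₀) m₀ rfl
    have hs' : Φ ∘ (s : _ → M) = id := hs
    have hsec : (s : _ → M) ∘ Φ = id := by
      refine cov.eq_of_comp_eq (s.continuous.comp cov.continuous) continuous_id ?_ m₀ ?_
      · change (Φ ∘ (s : _ → M)) ∘ Φ = Φ ∘ id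
        rw [hs']
        rfl
      · simp [hs₀]
    exact ⟨Function.LeftInverse.injective (g := s) fun m => congrFun hsec m,
      Function.RightInverse.surjective (g := s) fun y => congrFun hs' y⟩
  exact ⟨hloc.diffeomorphOfBijective hbij⟩

end Summit.SmoothPoincare4.SmoothPoincare4.Theses.SpectralDevelopingMap
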